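import Literature.Barriers.FinalStateConjecture.NonSmoothNullInfinityLogIntegral
import HarnessLib

/-!
# Barrier catalogue `FinalStateConjecture`: the linear scattering problem on Schwarzschild —
# the logarithmic expansion (6.18) of `∂ᵥ(rφ)` at order `n = 0`
(`Literature/Barriers/FinalStateConjecture/`, D-0021, D-0014; namespace
`Literature.Barriers.FinalStateConjecture`, sub-namespace `VExp`)

For the scattering field `χ` of data `H` (smooth, supported in `(v₁, v₂)`) this file proves
Kehrberger's expansion (6.18) at order `n = 0` (arXiv:2105.08079v3, Thm. 6.1 eq. (6.5) with the sign
of v3, = Thm. 4.3 eq. (4.45) transplanted to the linear setting), at fixed retarded time `u` and with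
all `v`-derivatives:

`∂ᵥχ(u, v) = f₀(u)/r³ − 6 I₀[H] M (log r − log|u|)/r⁴ + IsRem 4`,  `f₀(u) = −2M ∫_{−∞}^{u} χ(u', ∞) du'`

(`VExp.logExpansion_base`), where `I₀[H] = M∫H`, `χ(u', ∞)` is the limit of the radiation field on
`𝓘⁺` and `IsRem` is the remainder class of `NonSmoothNullInfinityVExpansion.lean`. The proof is the
direct evaluation of `∂ᵥχ = −∫_{−∞}^{u} Vχ du'` (beyond the support of the data): writing
`χ(u',v) = χ(u',∞) + (χ − χ(·,∞))` and `V = 2M/r³ − 4M²/r⁴`,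
* the part `χ − χ(·, ∞) = O(1/(|u'| r²))` and all terms of `∂ᵥ^m(Vχ)` containing `v`-derivatives of
  `χ` contribute `O(1/(|u| r^{4+m}))` (`VExp.abs_integral_eta_le`, by the Leibniz rule, the bounds
  of `NonSmoothNullInfinityDecayZero.lean` and the `R`-rule);
* the part `∫ ∂ᵥ^m V(u',v) χ(u',∞) du'` is `s_m ∫ ρ(u',v)^{3+m} χ(u',∞) du' + O(r^{−4−m})`
  (`s_m = (−1)^m (m+2)! M` the lowest coefficient of `∂ᵥ^m V`), and
  `∫ ρ(u',v)^k χ(u',∞) du' = ρ^k ∫χ(·,∞) + I₀ k (log r − log|u|) ρ^{k+1} + O(ρ^{k+1})`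
  (`VExp.abs_Zint_sub_le`) from `χ(u',∞) = −I₀/u'² + O(log|u'|/|u'|³)` ((6.17) at `n = 0` on `𝓘⁺`)
  and the logarithmic integral `J_k = −k Λ ρ^{k+1} + O(ρ^{k+1})` of
  `NonSmoothNullInfinityLogIntegral.lean`;
* the coefficients of `ρ^{3+m}` and `Λρ^{4+m}` then cancel exactly against those of
  `∂ᵥ^m (f₀ ρ³)` and `∂ᵥ^m (6 I₀ M Λ ρ⁴)` (the identities `s_m = 2M t_m`, `(3+m) t_m = 3 w_m` between the
  lowest coefficients of `∂ᵥ^m V`, `∂ᵥ^m ρ³`, `∂ᵥ^m ρ⁴`), which is the computation confirming the v3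
  sign `−(−1)ⁿ(n+3)! I⁽ⁿ⁾ M` of the logarithmic term.

## References

* L. M. A. Kehrberger, *The case against smooth null infinity I*, Ann. Henri Poincaré 23 (2022)
  829–921 = arXiv:2105.08079 (v3, 2023), Thm. 4.3 (proof), Thm. 6.1 eq. (6.5), §6.2.
  Key `Kehrberger2022AHP`.
-/

noncomputable section

open Set Filter Topology MeasureTheory intervalIntegral Function Asymptotics Polynomial
open Literature.Barriers.FinalStateConjecture.ScatDecay

namespace Literature.Barriers.FinalStateConjecture

namespace VExp

/-! ### Lowest coefficients of the cofactor polynomials -/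

/-- `S_m(0) = (−1)^m j(j+1)⋯(j+m−1) S(0)` for the cofactors of `δ^m (X^j S) = X^{j+m} S_m`. [folklore] -/
lemma vDerivCofactor_eval_zero (M : ℝ) (j : ℕ) (S : ℝ[X]) (m : ℕ) :
    (vDerivCofactor M j S m).eval 0 = (-1) ^ m * (∏ i ∈ Finset.range m, ((j : ℝ) + i)) * S.eval 0 := by
  induction m with
  | zero => simp [vDerivCofactor]
  | succ m ih =>
    simp only [vDerivCofactor, eval_neg, eval_mul, eval_add, eval_sub, eval_C, eval_X, eval_one, ih,
      Finset.prod_range_succ, zero_mul, add_zero, mul_zero, sub_zero, mul_one]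
    ring

/-- `3·4⋯(m+2)·(3+m) = 3 · 4·5⋯(m+3)`. [folklore] -/
lemma prod_range_three_mul : ∀ m : ℕ,
    (∏ i ∈ Finset.range m, ((3 : ℝ) + i)) * (3 + m) = 3 * ∏ i ∈ Finset.range m, ((4 : ℝ) + i)
  | 0 => by simp
  | m + 1 => by
    rw [Finset.prod_range_succ, Finset.prod_range_succ]
    have ih := prod_range_three_mul m
    push_cast
    calc (∏ i ∈ Finset.range m, ((3 : ℝ) + i)) * (3 + m) * (3 + (m + 1))
        = (3 * ∏ i ∈ Finset.range m, ((4 : ℝ) + i)) * (4 + m) := by rw [ih]; ring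
      _ = 3 * ((∏ i ∈ Finset.range m, ((4 : ℝ) + i)) * (4 + m)) := by ring

/-- `X ∣ S − C(S(0))`, as a bound: `|S(ρ) − S(0)| ≤ K ρ`. [folklore] -/
lemma exists_abs_eval_sub_eval_zero_le {M : ℝ} {r : ℝ → ℝ → ℝ} (hr : IsEFAreaRadius M r) (hM : 0 < M)
    (S : ℝ[X]) : ∃ K : ℝ, 0 ≤ K ∧ ∀ u v, |S.eval (r u v)⁻¹ - S.eval 0| ≤ K * (r u v)⁻¹ := by
  have hd : X ^ 1 ∣ S - C (S.eval 0) := by rw [pow_one, ← coeff_zero_eq_eval_zero]; exact X_dvd_sub_C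
  obtain ⟨K, hK0, hK⟩ := exists_abs_eval_le_of_dvd hr hM hd
  exact ⟨K, hK0, fun u v ↦ by simpa [pow_one] using hK u v⟩

/-! ### The base case -/

section Base

variable {M : ℝ} {r : ℝ → ℝ → ℝ} {v₁ v₂ U₀ A : ℝ} {H : ℝ → ℝ} {CH : ℝ}
variable (hr : IsEFAreaRadius M r) (hM : 0 < M)
  (hHd : ContDiff ℝ ((⊤ : ℕ∞) : WithTop ℕ∞) H) (hsupp : tsupport H ⊆ Ioo v₁ v₂)
  (hHb : ∀ v, |H v| ≤ CH) (hR : GoodRegion M r v₁ v₂ U₀ A) (h12 : v₁ ≤ v₂)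
include hr hM hR h12

/-- `χ(·, ∞)` is integrable on `(−∞, u]` for `u < U₀` (continuous there, `O(u'⁻²)`). [folklore] -/
lemma integrableOn_futureLimit {u : ℝ} (hu : u < U₀) :
    IntegrableOn (scatFutureLimit M r v₁ (scatteringField hr hM hHd.continuous hHb (data_eq_zero hsupp))) (Iic u) := by
  set χinf := scatFutureLimit M r v₁ (scatteringField hr hM hHd.continuous hHb (data_eq_zero hsupp)) with hχinf
  have hu0 : u < 0 := by linarith [hR.U₀_le]
  have hcont : ContinuousOn χinf (Iic u) :=
    (contDiffOn_futureLimit hr hM hHd hsupp hHb hR).continuousOn.mono fun x hx ↦ lt_of_le_of_lt (mem_Iic.1 hx) hu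
  obtain ⟨hint, -⟩ := integral_Iic_inv_pow 0 hu0
  refine Integrable.mono' (hint.const_mul (sqConst M CH v₁ v₂)) (hcont.aestronglyMeasurable measurableSet_Iic) ?_
  refine (ae_restrict_iff' measurableSet_Iic).2 (Eventually.of_forall fun x hx ↦ ?_)
  have h := abs_futureLimit_le hr hM hHd hsupp hHb hR h12 ((mem_Iic.1 hx).trans hu.le)
  rw [Real.norm_eq_abs]
  refine h.trans (le_of_eq ?_)
  ring

/-- The primitive `F̂(u) = ∫_{−∞}^{u} χ(u', ∞) du'` has derivative `χ(u, ∞)` on `(−∞, U₀)`. [folklore] -/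
lemma hasDerivAt_integral_futureLimit {u : ℝ} (hu : u < U₀) :
    HasDerivAt (fun u' ↦ ∫ x in Iic u', scatFutureLimit M r v₁ (scatteringField hr hM hHd.continuous hHb (data_eq_zero hsupp)) x)
      (scatFutureLimit M r v₁ (scatteringField hr hM hHd.continuous hHb (data_eq_zero hsupp)) u) u := by
  set χinf := scatFutureLimit M r v₁ (scatteringField hr hM hHd.continuous hHb (data_eq_zero hsupp)) with hχinf
  have hcont : ContinuousOn χinf (Iio U₀) := (contDiffOn_futureLimit hr hM hHd hsupp hHb hR).continuousOn
  -- near `u`: `∫_{Iic u'} = ∫_{Iic (u-1)} + ∫_{u-1}^{u'}`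
  have heq : (fun u' ↦ ∫ x in Iic u', χinf x) =ᶠ[𝓝 u]
      fun u' ↦ (∫ x in Iic (u - 1), χinf x) + ∫ x in (u - 1)..u', χinf x := by
    filter_upwards [Iio_mem_nhds hu] with u' hu'
    rw [← intervalIntegral.integral_Iic_sub_Iic (integrableOn_futureLimit hr hM hHd hsupp hHb hR h12 (by linarith))
      (integrableOn_futureLimit hr hM hHd hsupp hHb hR h12 hu')]
    ring
  refine HasDerivAt.congr_of_eventuallyEq ?_ heq
  have hcu : ContinuousAt χinf u := hcont.continuousAt (Iio_mem_nhds hu)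
  have hint : IntervalIntegrable χinf volume (u - 1) u := by
    refine (hcont.mono ?_).intervalIntegrable_of_Icc (by linarith)
    intro x hx; exact lt_of_le_of_lt hx.2 hu
  have h := intervalIntegral.integral_hasDerivAt_right hint
    (hcont.stronglyMeasurableAtFilter isOpen_Iio _ hu) hcu
  simpa using h.const_add (∫ x in Iic (u - 1), χinf x)

/-- **`u ↦ ∫_{−∞}^{u} χ(u', ∞) du'` is smooth on `(−∞, U₀)`.** [folklore] -/
theorem contDiffOn_integral_futureLimit :
    ContDiffOn ℝ ((⊤ : ℕ∞) : WithTop ℕ∞)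
      (fun u' ↦ ∫ x in Iic u', scatFutureLimit M r v₁ (scatteringField hr hM hHd.continuous hHb (data_eq_zero hsupp)) x)
      (Iio U₀) := by
  have hd := fun u (hu : u ∈ Iio U₀) ↦ hasDerivAt_integral_futureLimit hr hM hHd hsupp hHb hR h12 (u := u) hu
  refine (contDiffOn_infty_iff_deriv_of_isOpen isOpen_Iio).2 ⟨fun u hu ↦ (hd u hu).differentiableAt.differentiableWithinAt, ?_⟩
  exact (contDiffOn_futureLimit hr hM hHd hsupp hHb hR).congr fun u hu ↦ (hd u hu).deriv

omit hr in
/-- The constant of the logarithmic error is nonnegative. [folklore] -/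
lemma logConst_nonneg (hHb : ∀ v, |H v| ≤ CH) : 0 ≤ logConst M CH v₁ v₂ A := by
  have := data_bound_nonneg hHb
  have := hR.A_nonneg
  have := sqConst_nonneg (v₁ := v₁) (v₂ := v₂) hM hHb h12
  have : 0 ≤ v₂ - v₁ := by linarith
  unfold logConst
  positivity

/-- Integrands `u' ↦ ρ(u',v)^k P(ρ(u',v)) χ(u', ∞)` are integrable on `(−∞, u]`, `u < U₀`. [folklore] -/
lemma integrableOn_inv_pow_mul_eval_mul_futureLimit (k : ℕ) (P : ℝ[X]) {u : ℝ} (hu : u < U₀) (v : ℝ) :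
    IntegrableOn (fun u' ↦ (r u' v ^ k)⁻¹ * P.eval (r u' v)⁻¹ *
      scatFutureLimit M r v₁ (scatteringField hr hM hHd.continuous hHb (data_eq_zero hsupp)) u') (Iic u) := by
  set χinf := scatFutureLimit M r v₁ (scatteringField hr hM hHd.continuous hHb (data_eq_zero hsupp)) with hχinf
  obtain ⟨K, hK⟩ := exists_bound_eval_invRadius hr hM P
  have hK0 : 0 ≤ K := (abs_nonneg _).trans (hK 0 0)
  have hint := integrableOn_futureLimit hr hM hHd hsupp hHb hR h12 hu
  have hcont : ContinuousOn (fun u' ↦ (r u' v ^ k)⁻¹ * P.eval (r u' v)⁻¹ * χinf u') (Iic u) := by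
    have hcr := continuous_radius_left hr hM v
    have hne : ∀ y, r y v ≠ 0 := fun y ↦ (hr.pos hM.le y v).ne'
    have h1 : Continuous fun u' ↦ (r u' v ^ k)⁻¹ * P.eval (r u' v)⁻¹ :=
      ((hcr.pow _).inv₀ fun y ↦ pow_ne_zero _ (hne y)).mul (P.continuous.comp (hcr.inv₀ hne))
    exact h1.continuousOn.mul ((contDiffOn_futureLimit hr hM hHd hsupp hHb hR).continuousOn.mono
      fun x hx ↦ lt_of_le_of_lt (mem_Iic.1 hx) hu)
  refine Integrable.mono' (hint.norm.const_mul ((r u v ^ k)⁻¹ * K)) (hcont.aestronglyMeasurable measurableSet_Iic) ?_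
  refine (ae_restrict_iff' measurableSet_Iic).2 (Eventually.of_forall fun x hx ↦ ?_)
  have h1 : (r x v ^ k)⁻¹ ≤ (r u v ^ k)⁻¹ := inv_radius_pow_le_of_le hr hM (mem_Iic.1 hx) k
  have h0 : 0 ≤ (r x v ^ k)⁻¹ := by have := hr.pos hM.le x v; positivity
  rw [Real.norm_eq_abs, abs_mul, abs_mul, abs_of_nonneg h0, Real.norm_eq_abs]
  have := hK x v
  have h2 : 0 ≤ (r u v ^ k)⁻¹ := by have := hr.pos hM.le u v; positivity
  calc (r x v ^ k)⁻¹ * |P.eval (r x v)⁻¹| * |χinf x| ≤ (r u v ^ k)⁻¹ * K * |χinf x| := by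
        gcongr
    _ = (r u v ^ k)⁻¹ * K * |χinf x| := rfl

/-- **The `η`-part of `∂ᵥ^m Ξ`**: `|∫_{−∞}^{u} (∂ᵥ^m(Vχ)(u',v) − ∂ᵥ^m V(u',v) χ(u',∞)) du'| ≤
C/(|u| r(u,v)^{m+4})` for `u < U₀`, `v ≥ v₂` (Leibniz rule: the terms are `∂ᵥ^m V · (χ − χ(·,∞))` and
`∂ᵥ^i V ∂ᵥ^{m−i} χ`, `i < m`, all `O(ρ^{5+m}/|u'|)`; then the `R`-rule). [folklore] -/
theorem abs_integral_eta_le (m : ℕ) :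
    ∃ C : ℝ, 0 ≤ C ∧ ∀ u, u < U₀ → ∀ v, v₂ ≤ v →
      |uPrimitive (fun u' v ↦ iteratedDeriv m (fun v' ↦ radialPotential M (r u' v') *
          scatteringField hr hM hHd.continuous hHb (data_eq_zero hsupp) u' v') v -
        iteratedDeriv m (fun v' ↦ radialPotential M (r u' v')) v *
          scatFutureLimit M r v₁ (scatteringField hr hM hHd.continuous hHb (data_eq_zero hsupp)) u') u v| ≤
      C * ((-u)⁻¹ * (r u v ^ (m + 4))⁻¹) := by
  set χ := scatteringField hr hM hHd.continuous hHb (data_eq_zero hsupp) with hχ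
  set χinf := scatFutureLimit M r v₁ χ with hχinf
  have hb : ScatBootstrap M r v₁ H χ := scatBootstrap_scatteringField hr hM hHd hsupp hHb
  choose K hK0 hK using fun i ↦ abs_iteratedDeriv_potential_le hr hM i
  obtain ⟨Cb, hCb0, hCb⟩ := abs_iteratedDeriv_le hr hM hHd hsupp hHb hR h12 m
  have hB2 : 0 ≤ sqConst M CH v₁ v₂ := sqConst_nonneg (v₁ := v₁) (v₂ := v₂) hM hHb h12
  set T : ℝ := 2 * M * sqConst M CH v₁ v₂ * K m + ∑ i ∈ Finset.range m, (m.choose i : ℝ) * K i * Cb with hT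
  have hT0 : 0 ≤ T := by
    have : 0 ≤ ∑ i ∈ Finset.range m, (m.choose i : ℝ) * K i * Cb :=
      Finset.sum_nonneg fun i _ ↦ mul_nonneg (mul_nonneg (Nat.cast_nonneg _) (hK0 i)) hCb0
    have := hK0 m
    positivity
  refine ⟨2 * T * (((m : ℝ) + 3) + 1)⁻¹, by positivity, fun u hu v hv ↦ ?_⟩
  have hle : ((m : ℕ) : WithTop ℕ∞) ≤ ((⊤ : ℕ∞) : WithTop ℕ∞) := by exact_mod_cast le_top
  -- pointwise bound along the ray
  have hint : ∀ u', u' ≤ u → |iteratedDeriv m (fun v' ↦ radialPotential M (r u' v') * χ u' v') v -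
      iteratedDeriv m (fun v' ↦ radialPotential M (r u' v')) v * χinf u'| ≤
      T * (((-u') ^ 1)⁻¹ * (r u' v ^ ((m + 3) + 2))⁻¹) := by
    intro u' hu'
    have hu'U : u' ≤ U₀ := hu'.trans hu.le
    have hu'0 : 0 < -u' := hR.neg_pos hu'U
    have hr0 : 0 < r u' v := hr.pos hM.le u' v
    have hVc : ContDiffAt ℝ m (fun v' ↦ radialPotential M (r u' v')) v :=
      ((contDiff_potential_right hr hM u').of_le hle).contDiffAt
    have hχc : ContDiffAt ℝ m (fun v' ↦ χ u' v') v := ((contDiff_right hr hM hb ScatFam.sol u').of_le hle).contDiffAt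
    rw [iteratedDeriv_fun_mul hVc hχc, Finset.sum_range_succ, Nat.choose_self, Nat.cast_one, one_mul,
      Nat.sub_self, iteratedDeriv_zero, add_sub_assoc, ← mul_sub]
    -- the `i = m` term with `χ − χ(·, ∞)`
    have h1 : |iteratedDeriv m (fun v' ↦ radialPotential M (r u' v')) v * (χ u' v - χinf u')| ≤
        2 * M * sqConst M CH v₁ v₂ * K m * ((-u')⁻¹ * (r u' v ^ (m + 5))⁻¹) := by
      rw [abs_mul]
      have ha := hK m u' v
      have hb' := abs_sub_futureLimit_le hr hM hHd hsupp hHb hR h12 hu'U hv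
      calc |iteratedDeriv m (fun v' ↦ radialPotential M (r u' v')) v| * |χ u' v - χinf u'|
          ≤ (K m * (r u' v ^ (3 + m))⁻¹) * (2 * M * sqConst M CH v₁ v₂ * ((-u')⁻¹ * (r u' v ^ 2)⁻¹)) :=
            mul_le_mul ha hb' (abs_nonneg _) (mul_nonneg (hK0 m) (by positivity))
        _ = 2 * M * sqConst M CH v₁ v₂ * K m * ((-u')⁻¹ * ((r u' v ^ (3 + m))⁻¹ * (r u' v ^ 2)⁻¹)) := by ring
        _ = 2 * M * sqConst M CH v₁ v₂ * K m * ((-u')⁻¹ * (r u' v ^ (m + 5))⁻¹) := by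
            rw [← mul_inv, ← pow_add, show 3 + m + 2 = m + 5 by ring]
    -- the terms `i < m`
    have h2 : ∀ i ∈ Finset.range m, |(m.choose i : ℝ) * iteratedDeriv i (fun v' ↦ radialPotential M (r u' v')) v *
        iteratedDeriv (m - i) (fun v' ↦ χ u' v') v| ≤ (m.choose i : ℝ) * K i * Cb * ((-u')⁻¹ * (r u' v ^ (m + 5))⁻¹) := by
      intro i hi
      have him : i < m := Finset.mem_range.1 hi
      rw [abs_mul, abs_mul, Nat.abs_cast]
      have ha := hK i u' v
      have hb' := hCb (m - i) (by omega) (by omega) u' hu'U v hv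
      calc (m.choose i : ℝ) * |iteratedDeriv i (fun v' ↦ radialPotential M (r u' v')) v| *
            |iteratedDeriv (m - i) (fun v' ↦ χ u' v') v|
          ≤ (m.choose i : ℝ) * (K i * (r u' v ^ (3 + i))⁻¹) * (Cb * ((-u')⁻¹ * (r u' v ^ (m - i + 2))⁻¹)) :=
            mul_le_mul (mul_le_mul_of_nonneg_left ha (Nat.cast_nonneg _)) hb' (abs_nonneg _)
              (mul_nonneg (Nat.cast_nonneg _) (mul_nonneg (hK0 i) (by positivity)))
        _ = (m.choose i : ℝ) * K i * Cb * ((-u')⁻¹ * ((r u' v ^ (3 + i))⁻¹ * (r u' v ^ (m - i + 2))⁻¹)) := by ring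
        _ = (m.choose i : ℝ) * K i * Cb * ((-u')⁻¹ * (r u' v ^ (m + 5))⁻¹) := by
            rw [← mul_inv, ← pow_add]; congr 4; omega
    refine (abs_add_le _ _).trans ?_
    refine (add_le_add ((Finset.abs_sum_le_sum_abs _ _).trans (Finset.sum_le_sum h2)) h1).trans (le_of_eq ?_)
    rw [← Finset.sum_mul, pow_one, show (m + 3) + 2 = m + 5 by ring]
    ring
  -- the `R`-rule
  have hR' := abs_uPrimitive_le_R hr hM hR (C := T) (a := 1) (b := m + 3) hu.le (h12.trans hv)
    (h := fun u' v ↦ iteratedDeriv m (fun v' ↦ radialPotential M (r u' v') * χ u' v') v -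
      iteratedDeriv m (fun v' ↦ radialPotential M (r u' v')) v * χinf u') hint
  refine hR'.trans (le_of_eq ?_)
  push_cast
  rw [pow_one, show m + 3 + 1 = m + 4 by ring, mul_inv]
  ring

/-- **The higher-order part of `∂ᵥ^m V`**: with `∂ᵥ^m V = ρ^{3+m} S_m(ρ)`,
`|∫_{−∞}^{u} ρ^{3+m} (S_m(ρ) − S_m(0)) χ(u', ∞) du'| ≤ C/(|u| r(u,v)^{m+4})` for `u < U₀` (all `v`; the
`U`-rule with `|χ(u', ∞)| ≤ B₂/u'²`). [folklore] -/
theorem abs_integral_cofactor_sub_le (m : ℕ) :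
    ∃ K₀ : ℝ, 0 ≤ K₀ ∧ ∀ u, u < U₀ → ∀ v,
      |uPrimitive (fun u' v ↦ (r u' v ^ (3 + m))⁻¹ *
        ((vDerivCofactor M 3 (C (2 * M) - C (4 * M ^ 2) * X) m).eval (r u' v)⁻¹ -
          (vDerivCofactor M 3 (C (2 * M) - C (4 * M ^ 2) * X) m).eval 0) *
        scatFutureLimit M r v₁ (scatteringField hr hM hHd.continuous hHb (data_eq_zero hsupp)) u') u v| ≤
      K₀ * ((-u)⁻¹ * (r u v ^ (m + 4))⁻¹) := by
  set S := vDerivCofactor M 3 (C (2 * M) - C (4 * M ^ 2) * X) m with hS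
  set χinf := scatFutureLimit M r v₁ (scatteringField hr hM hHd.continuous hHb (data_eq_zero hsupp)) with hχinf
  obtain ⟨K, hK0, hK⟩ := exists_abs_eval_sub_eval_zero_le hr hM S
  have hB2 : 0 ≤ sqConst M CH v₁ v₂ := sqConst_nonneg (v₁ := v₁) (v₂ := v₂) hM hHb h12
  refine ⟨K * sqConst M CH v₁ v₂, by positivity, fun u hu v ↦ ?_⟩
  have hint : ∀ u', u' ≤ u → |(r u' v ^ (3 + m))⁻¹ * (S.eval (r u' v)⁻¹ - S.eval 0) * χinf u'| ≤
      K * sqConst M CH v₁ v₂ * (((-u') ^ (0 + 2))⁻¹ * (r u' v ^ (m + 4))⁻¹) := by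
    intro u' hu'
    have hu'U : u' ≤ U₀ := hu'.trans hu.le
    have hr0 : 0 < r u' v := hr.pos hM.le u' v
    have h1 := hK u' v
    have h2 : |χinf u'| ≤ sqConst M CH v₁ v₂ * (u' ^ 2)⁻¹ := abs_futureLimit_le hr hM hHd hsupp hHb hR h12 hu'U
    rw [abs_mul, abs_mul, abs_of_pos (by positivity : (0 : ℝ) < (r u' v ^ (3 + m))⁻¹)]
    calc (r u' v ^ (3 + m))⁻¹ * |S.eval (r u' v)⁻¹ - S.eval 0| * |χinf u'|
        ≤ (r u' v ^ (3 + m))⁻¹ * (K * (r u' v)⁻¹) * (sqConst M CH v₁ v₂ * (u' ^ 2)⁻¹) :=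
          mul_le_mul (mul_le_mul_of_nonneg_left h1 (by positivity)) h2 (abs_nonneg _) (by positivity)
      _ = K * sqConst M CH v₁ v₂ * ((u' ^ 2)⁻¹ * ((r u' v ^ (3 + m))⁻¹ * (r u' v)⁻¹)) := by ring
      _ = K * sqConst M CH v₁ v₂ * (((-u') ^ (0 + 2))⁻¹ * (r u' v ^ (m + 4))⁻¹) := by
          rw [← mul_inv, ← pow_succ, show 3 + m + 1 = m + 4 by ring, zero_add, neg_sq]
  have hU := abs_uPrimitive_le_U hr hM hR (C := K * sqConst M CH v₁ v₂) (a := 0) (b := m + 4) hu.le (v := v)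
    (h := fun u' v ↦ (r u' v ^ (3 + m))⁻¹ * (S.eval (r u' v)⁻¹ - S.eval 0) * χinf u') hint
  refine hU.trans (le_of_eq ?_)
  norm_num

/-- **The expansion of `Z_k(u, v) = ∫_{−∞}^{u} ρ(u',v)^k χ(u', ∞) du'`** (`k ≥ 3`, fixed `u < U₀`):
`Z_k = ρ^k F̂(u) + I₀ k Λ ρ^{k+1} + O(ρ^{k+1})` for `r(u,v) ≥ max(4M, |u|)`, `v ≥ v₂`, where
`F̂(u) = ∫_{−∞}^{u} χ(·, ∞)` and `I₀ = M∫H`: insert `χ(u',∞) = −I₀/u'² + e(u')`,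
`|e| ≤ C log|u'|/|u'|³`, and use `J_k = −kΛρ^{k+1} + O(ρ^{k+1})`, `|ρ₀^k − ρ^k| ≤ kρ₀^{k+1}(u − u')`.
[cite: Kehrberger2022AHP, proof of Thm. 4.3] -/
theorem abs_Zint_sub_le (k : ℕ) {u : ℝ} (hu : u < U₀) :
    ∃ C : ℝ, ∀ v, 4 * M ≤ r u v → -u ≤ r u v →
      |(∫ u' in Iic u, (r u' v ^ (k + 3))⁻¹ *
          scatFutureLimit M r v₁ (scatteringField hr hM hHd.continuous hHb (data_eq_zero hsupp)) u') -
        (r u v ^ (k + 3))⁻¹ * (∫ u' in Iic u,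
          scatFutureLimit M r v₁ (scatteringField hr hM hHd.continuous hHb (data_eq_zero hsupp)) u') -
        (M * ∫ v' in v₁..v₂, H v') * ((k : ℝ) + 3) * logRatio r u v * (r u v ^ (k + 4))⁻¹| ≤
      C * (r u v ^ (k + 4))⁻¹ := by
  set χinf := scatFutureLimit M r v₁ (scatteringField hr hM hHd.continuous hHb (data_eq_zero hsupp)) with hχinf
  set I₀ : ℝ := M * ∫ v' in v₁..v₂, H v' with hI₀
  set CL := logConst M CH v₁ v₂ A with hCL
  have hu0 : u < 0 := by linarith [hR.U₀_le]
  have hu1 : u ≤ -1 := by linarith [hR.U₀_le]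
  have hCLnn : 0 ≤ CL := logConst_nonneg hM hR h12 hHb
  obtain ⟨CJ, hCJ⟩ := abs_Jint_add_le hr hM (k + 2) hu0
  obtain ⟨hintlog, hvallog⟩ := integral_Iic_log_div_sq hu1
  refine ⟨|I₀| * CJ + ((k : ℝ) + 3) * CL * ((Real.log (-u) + 1) / (-u)), fun v h4 huv ↦ ?_⟩
  set ρ₀ : ℕ → ℝ := fun n ↦ (r u v ^ n)⁻¹ with hρ₀
  -- the three integrable pieces
  have hintχ := integrableOn_futureLimit hr hM hHd hsupp hHb hR h12 hu
  have hintA : IntegrableOn (fun u' ↦ (r u' v ^ (k + 3))⁻¹ * χinf u') (Iic u) := by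
    have h := integrableOn_inv_pow_mul_eval_mul_futureLimit hr hM hHd hsupp hHb hR h12 (k + 3) 1 hu v
    simpa using h
  obtain ⟨hintu2, -⟩ := integral_Iic_inv_pow 0 hu0
  have hcr := continuous_radius_left hr hM v
  have hne : ∀ y, r y v ≠ 0 := fun y ↦ (hr.pos hM.le y v).ne'
  have hintC : IntegrableOn (fun u' ↦ (u' ^ 2)⁻¹ * ((r u' v ^ (k + 3))⁻¹ - (r u v ^ (k + 3))⁻¹)) (Iic u) := by
    have hc : ContinuousOn (fun u' ↦ (u' ^ 2)⁻¹ * ((r u' v ^ (k + 3))⁻¹ - (r u v ^ (k + 3))⁻¹)) (Iic u) := by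
      intro x hx
      have hx0 : x ≠ 0 := by have := mem_Iic.1 hx; intro h; linarith
      exact ((((continuous_pow 2).continuousAt).inv₀ (pow_ne_zero _ hx0)).mul
        ((((hcr.pow _).continuousAt).inv₀ (pow_ne_zero _ (hne x))).sub continuousAt_const)).continuousWithinAt
    refine Integrable.mono' (hintu2.const_mul ((r u v ^ (k + 3))⁻¹)) (hc.aestronglyMeasurable measurableSet_Iic) ?_
    refine (ae_restrict_iff' measurableSet_Iic).2 (Eventually.of_forall fun x hx ↦ ?_)
    have hx' : x ≤ u := mem_Iic.1 hx
    have hs0 : 0 ≤ (r u v ^ (k + 3))⁻¹ - (r x v ^ (k + 3))⁻¹ := inv_pow_sub_nonneg hr hM _ hx'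
    have hs1 : (r u v ^ (k + 3))⁻¹ - (r x v ^ (k + 3))⁻¹ ≤ (r u v ^ (k + 3))⁻¹ := by
      have : 0 ≤ (r x v ^ (k + 3))⁻¹ := by have := hr.pos hM.le x v; positivity
      linarith
    rw [Real.norm_eq_abs, abs_mul, abs_of_nonneg (by positivity), abs_sub_comm, abs_of_nonneg hs0,
      mul_comm ((r u v ^ (k + 3))⁻¹)]
    refine (mul_le_mul_of_nonneg_left hs1 (by positivity)).trans (le_of_eq ?_)
    norm_num
  -- the `e`-term and its bound
  set eterm : ℝ → ℝ := fun u' ↦ ((r u' v ^ (k + 3))⁻¹ - (r u v ^ (k + 3))⁻¹) * (χinf u' + I₀ * (u' ^ 2)⁻¹) with he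
  have heq : ∀ u', eterm u' = (r u' v ^ (k + 3))⁻¹ * χinf u' - (r u v ^ (k + 3))⁻¹ * χinf u' +
      I₀ * ((u' ^ 2)⁻¹ * ((r u' v ^ (k + 3))⁻¹ - (r u v ^ (k + 3))⁻¹)) := fun u' ↦ by
    simp only [he]; ring
  have hintE : IntegrableOn eterm (Iic u) := by
    have : eterm = fun u' ↦ (r u' v ^ (k + 3))⁻¹ * χinf u' - (r u v ^ (k + 3))⁻¹ * χinf u' +
        I₀ * ((u' ^ 2)⁻¹ * ((r u' v ^ (k + 3))⁻¹ - (r u v ^ (k + 3))⁻¹)) := funext heq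
    rw [this]
    exact (hintA.sub (hintχ.const_mul _)).add (hintC.const_mul _)
  have hintB : IntegrableOn (fun u' ↦ (r u v ^ (k + 3))⁻¹ * χinf u') (Iic u) := hintχ.const_mul _
  have hintAB : IntegrableOn (fun u' ↦ (r u' v ^ (k + 3))⁻¹ * χinf u' - (r u v ^ (k + 3))⁻¹ * χinf u') (Iic u) :=
    hintA.sub hintB
  have hintIC : IntegrableOn (fun u' ↦ I₀ * ((u' ^ 2)⁻¹ * ((r u' v ^ (k + 3))⁻¹ - (r u v ^ (k + 3))⁻¹))) (Iic u) :=
    hintC.const_mul _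
  have hEval : ∫ u' in Iic u, eterm u' = (∫ u' in Iic u, (r u' v ^ (k + 3))⁻¹ * χinf u') -
      (r u v ^ (k + 3))⁻¹ * (∫ u' in Iic u, χinf u') + I₀ * Jint r (k + 3) u v := by
    rw [show (∫ u' in Iic u, eterm u') = ∫ u' in Iic u, ((r u' v ^ (k + 3))⁻¹ * χinf u' -
        (r u v ^ (k + 3))⁻¹ * χinf u' + I₀ * ((u' ^ 2)⁻¹ * ((r u' v ^ (k + 3))⁻¹ - (r u v ^ (k + 3))⁻¹))) from
      integral_congr_ae (Eventually.of_forall heq),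
      integral_add hintAB hintIC, integral_sub hintA hintB,
      MeasureTheory.integral_const_mul, MeasureTheory.integral_const_mul, Jint]
  have hEbound : |∫ u' in Iic u, eterm u'| ≤ ((k : ℝ) + 3) * CL * ((Real.log (-u) + 1) / (-u)) * ρ₀ (k + 4) := by
    have hmaj : ∀ x ∈ Iic u, |eterm x| ≤ ((k : ℝ) + 3) * CL * ρ₀ (k + 4) * (Real.log (-x) / x ^ 2) := by
      intro x hx
      have hx' : x ≤ u := mem_Iic.1 hx
      have hxU : x ≤ U₀ := hx'.trans hu.le
      have hx0 : 0 < -x := by linarith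
      have hlog0 : 0 ≤ Real.log (-x) := Real.log_nonneg (by linarith)
      have hker := inv_pow_sub_le hr hM (k + 2) (v := v) hx'
      rw [show k + 2 + 1 = k + 3 by ring] at hker
      push_cast at hker
      have hker0 := inv_pow_sub_nonneg hr hM (k + 3) (v := v) hx'
      have he' : |χinf x + I₀ * (x ^ 2)⁻¹| ≤ CL * Real.log (-x) * ((-x) ^ 3)⁻¹ := by
        have := abs_futureLimit_add_moment_le hr hM hHd hsupp hHb hR h12 hxU
        simpa [hI₀, mul_assoc] using this
      have hCL0 : 0 ≤ CL * Real.log (-x) * ((-x) ^ 3)⁻¹ := (abs_nonneg _).trans he'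
      simp only [he]
      rw [abs_mul, abs_sub_comm, abs_of_nonneg hker0]
      calc ((r u v ^ (k + 3))⁻¹ - (r x v ^ (k + 3))⁻¹) * |χinf x + I₀ * (x ^ 2)⁻¹|
          ≤ (((k : ℝ) + 2 + 1) * (r u v ^ (k + 2 + 2))⁻¹ * (u - x)) * (CL * Real.log (-x) * ((-x) ^ 3)⁻¹) :=
            mul_le_mul hker he' (abs_nonneg _) (by
              have : 0 ≤ u - x := by linarith
              have := hr.pos hM.le u v; positivity)
        _ = ((k : ℝ) + 3) * CL * ρ₀ (k + 4) * (((u - x) * ((-x) ^ 3)⁻¹) * Real.log (-x)) := by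
            simp only [hρ₀, show k + 2 + 2 = k + 4 by ring]; ring
        _ ≤ ((k : ℝ) + 3) * CL * ρ₀ (k + 4) * ((x ^ 2)⁻¹ * Real.log (-x)) := by
            refine mul_le_mul_of_nonneg_left (mul_le_mul_of_nonneg_right ?_ hlog0) ?_
            · -- `(u − x)/(-x)^3 ≤ 1/x²` since `u − x ≤ −x`
              rw [show (x ^ 2)⁻¹ = (-x) * ((-x) ^ 3)⁻¹ by field_simp]
              exact mul_le_mul_of_nonneg_right (by linarith) (by positivity)
            · have := hr.pos hM.le u v
              simp only [hρ₀]; positivity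
        _ = ((k : ℝ) + 3) * CL * ρ₀ (k + 4) * (Real.log (-x) / x ^ 2) := by rw [div_eq_mul_inv]; ring
    have h := norm_integral_le_of_norm_le (hintlog.const_mul (((k : ℝ) + 3) * CL * ρ₀ (k + 4)))
      ((ae_restrict_iff' measurableSet_Iic).2 (Eventually.of_forall fun x hx ↦ by
        rw [Real.norm_eq_abs]; exact hmaj x hx))
    rw [Real.norm_eq_abs, MeasureTheory.integral_const_mul, hvallog] at h
    refine h.trans (le_of_eq ?_)
    ring
  -- assemble with the `J`-asymptotics
  have hJ := hCJ v h4 huv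
  rw [show k + 2 + 1 = k + 3 by ring, show k + 2 + 2 = k + 4 by ring] at hJ
  push_cast at hJ
  have hkey : (∫ u' in Iic u, (r u' v ^ (k + 3))⁻¹ * χinf u') - (r u v ^ (k + 3))⁻¹ * (∫ u' in Iic u, χinf u') -
      I₀ * ((k : ℝ) + 3) * logRatio r u v * (r u v ^ (k + 4))⁻¹ =
      (∫ u' in Iic u, eterm u') - I₀ * (Jint r (k + 3) u v + ((k : ℝ) + 2 + 1) * logRatio r u v * (r u v ^ (k + 4))⁻¹) := by
    rw [hEval]
    ring
  rw [hkey]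
  refine (abs_sub _ _).trans ?_
  rw [abs_mul]
  have h1 : |I₀| * |Jint r (k + 3) u v + ((k : ℝ) + 2 + 1) * logRatio r u v * (r u v ^ (k + 4))⁻¹| ≤
      |I₀| * (CJ * (r u v ^ (k + 4))⁻¹) := mul_le_mul_of_nonneg_left hJ (abs_nonneg _)
  have h2 := hEbound
  simp only [hρ₀] at h2
  calc |∫ u' in Iic u, eterm u'| + |I₀| * |Jint r (k + 3) u v + ((k : ℝ) + 2 + 1) * logRatio r u v * (r u v ^ (k + 4))⁻¹|
      ≤ ((k : ℝ) + 3) * CL * ((Real.log (-u) + 1) / (-u)) * (r u v ^ (k + 4))⁻¹ + |I₀| * (CJ * (r u v ^ (k + 4))⁻¹) :=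
        add_le_add h2 h1
    _ = (|I₀| * CJ + ((k : ℝ) + 3) * CL * ((Real.log (-u) + 1) / (-u))) * (r u v ^ (k + 4))⁻¹ := by ring

omit hR h12 in
/-- `∂ᵥ^m (Vχ)(·, v)` is integrable on `(−∞, u]`. [folklore] -/
lemma integrableOn_iteratedDeriv_potential_mul_field (m : ℕ) (u v : ℝ) :
    IntegrableOn (fun u' ↦ iteratedDeriv m (fun v' ↦ radialPotential M (r u' v') *
      scatteringField hr hM hHd.continuous hHb (data_eq_zero hsupp) u' v') v) (Iic u) := by
  have hb := scatBootstrap_scatteringField hr hM hHd hsupp hHb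
  obtain ⟨hc, hd⟩ := continuous_iteratedDeriv_potential_mul hr hM hb ScatFam.sol m
  exact hd.integrableOn hr hM hc u v

/-- **Kehrberger's expansion (6.18) at order `n = 0` for the constructed field, with all
`v`-derivatives, at fixed `u < U₀`:**
`∂ᵥχ(u,·) − f₀(u)/r³ + 6 I₀ M (log r − log|u|)/r⁴ ∈ IsRem 4`, with the smooth coefficient
`f₀(u) = −2M ∫_{−∞}^{u} χ(u', ∞) du'` and `I₀ = M ∫H` (v3 sign of the logarithmic term).
[cite: Kehrberger2022AHP, Thm. 6.1 eq. (6.5), proof of Thm. 4.3] -/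
theorem logExpansion_base :
    ∃ f₀ : ℝ → ℝ, ContDiffOn ℝ ((⊤ : ℕ∞) : WithTop ℕ∞) f₀ (Iio U₀) ∧ ∀ u, u < U₀ →
      IsRem r u 4 (fun v ↦ deriv (fun v' ↦ scatteringField hr hM hHd.continuous hHb (data_eq_zero hsupp) u v') v -
        f₀ u * (r u v ^ 3)⁻¹ +
        6 * (M * ∫ v' in v₁..v₂, H v') * M * logRatio r u v * (r u v ^ 4)⁻¹) := by
  set χ := scatteringField hr hM hHd.continuous hHb (data_eq_zero hsupp) with hχ
  set χinf := scatFutureLimit M r v₁ χ with hχinf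
  have hb : ScatBootstrap M r v₁ H χ := scatBootstrap_scatteringField hr hM hHd hsupp hHb
  refine ⟨fun u ↦ -(2 * M) * ∫ x in Iic u, χinf x,
    contDiffOn_const.mul (contDiffOn_integral_futureLimit hr hM hHd hsupp hHb hR h12), fun u hu ↦ ?_⟩
  set I₀ : ℝ := M * ∫ v' in v₁..v₂, H v' with hI₀
  set Fhat : ℝ := ∫ x in Iic u, χinf x with hFhat
  show IsRem r u 4 (fun v ↦ deriv (fun v' ↦ χ u v') v - (-(2 * M) * Fhat) * (r u v ^ 3)⁻¹ +
    6 * I₀ * M * logRatio r u v * (r u v ^ 4)⁻¹)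
  have hu0 : u < 0 := by linarith [hR.U₀_le]
  -- smoothness of the three ingredients
  have hχs : ContDiff ℝ ((⊤ : ℕ∞) : WithTop ℕ∞) (fun v ↦ χ u v) := contDiff_right hr hM hb ScatFam.sol u
  have hD : ContDiff ℝ ((⊤ : ℕ∞) : WithTop ℕ∞) (deriv fun v' ↦ χ u v') := (contDiff_infty_iff_deriv.1 hχs).2
  have hP3 : ContDiff ℝ ((⊤ : ℕ∞) : WithTop ℕ∞) (fun v ↦ (r u v ^ 3)⁻¹) := (isRem_inv_pow hr hM u 3).1
  have hP4 : ContDiff ℝ ((⊤ : ℕ∞) : WithTop ℕ∞) (fun v ↦ (r u v ^ 4)⁻¹) := (isRem_inv_pow hr hM u 4).1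
  have hL4 : ContDiff ℝ ((⊤ : ℕ∞) : WithTop ℕ∞) (fun v ↦ logRatio r u v * (r u v ^ 4)⁻¹) :=
    (contDiff_logRatio hr hM u).mul hP4
  -- regroup the constant of the logarithmic term
  have hfunE : (fun v ↦ deriv (fun v' ↦ χ u v') v - (-(2 * M) * Fhat) * (r u v ^ 3)⁻¹ +
      6 * I₀ * M * logRatio r u v * (r u v ^ 4)⁻¹) =
      fun v ↦ (deriv (fun v' ↦ χ u v') v - (-(2 * M) * Fhat) * (r u v ^ 3)⁻¹) +
        (6 * I₀ * M) * (logRatio r u v * (r u v ^ 4)⁻¹) := by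
    funext v; ring
  rw [hfunE]
  refine ⟨(hD.sub (contDiff_const.mul hP3)).add (contDiff_const.mul hL4), fun m ↦ ?_⟩
  rw [show 4 + m = m + 4 by ring]
  -- constants for order `m`
  obtain ⟨Cη, -, hCη⟩ := abs_integral_eta_le hr hM hHd hsupp hHb hR h12 m
  obtain ⟨Cc, -, hCc⟩ := abs_integral_cofactor_sub_le hr hM hHd hsupp hHb hR h12 m
  obtain ⟨CZ, hCZ⟩ := abs_Zint_sub_le hr hM hHd hsupp hHb hR h12 m hu
  set S : ℝ[X] := vDerivCofactor M 3 (C (2 * M) - C (4 * M ^ 2) * X) m with hS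
  set cof3 : ℝ[X] := vDerivCofactor M 3 1 m with hcof3
  set cof4 : ℝ[X] := vDerivCofactor M 4 1 m with hcof4
  set s : ℝ := S.eval 0 with hs
  set t : ℝ := cof3.eval 0 with ht
  set w : ℝ := cof4.eval 0 with hw
  obtain ⟨K3, hK30, hK3⟩ := exists_abs_eval_sub_eval_zero_le hr hM cof3
  obtain ⟨K4, hK40, hK4⟩ := exists_abs_eval_sub_eval_zero_le hr hM cof4
  set R : ℝ[X] := logRemPoly M (X ^ 4 * 1) m with hRdef
  obtain ⟨KR, hKR0, hKR⟩ := exists_abs_eval_le_of_dvd hr hM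
    (X_pow_dvd_logRemPoly (M := M) (dvd_mul_right ((X : ℝ[X]) ^ 4) 1) m)
  obtain ⟨L, hL0, hL⟩ := exists_abs_logRatio_mul_inv_le hr hM u
  -- the coefficient identities `s = 2M t`, `(m+3) t = 3 w`
  have hst : s = 2 * M * t := by
    simp only [hs, ht, hS, hcof3, vDerivCofactor_eval_zero, eval_sub, eval_mul, eval_C, eval_X, mul_zero, sub_zero,
      eval_one]
    ring
  have htw : ((m : ℝ) + 3) * t = 3 * w := by
    simp only [ht, hw, hcof3, hcof4, vDerivCofactor_eval_zero, eval_one, mul_one]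
    have h := prod_range_three_mul m
    push_cast at h ⊢
    linear_combination (-1 : ℝ) ^ m * h
  -- a threshold beyond which `r(u, v) ≥ max(4M, |u|)` and `v ≥ v₂`
  obtain ⟨v₀, hv₀⟩ := eventually_atTop.1 ((hr.tendsto_atTop hM.le u).eventually (eventually_ge_atTop (max (4 * M) (-u))))
  refine IsBigO.of_bound (|s| * CZ + Cc * (-u)⁻¹ + Cη * (-u)⁻¹ + |(-(2 * M) * Fhat)| * K3 + |6 * I₀ * M| * (K4 * L) +
    |6 * I₀ * M| * KR) ?_
  filter_upwards [eventually_ge_atTop (max v₀ v₂)] with v hv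
  have hv2 : v₂ ≤ v := (le_max_right _ _).trans hv
  have hv0 : v₀ ≤ v := (le_max_left _ _).trans hv
  have h4 : 4 * M ≤ r u v := (le_max_left _ _).trans (hv₀ v hv0)
  have huv : -u ≤ r u v := (le_max_right _ _).trans (hv₀ v hv0)
  have hr0 : 0 < r u v := hr.pos hM.le u v
  -- the bounds specialised at `(u, v)` (stated before abbreviating, so that the abbreviations fold in)
  have hZ := hCZ v h4 huv
  have hcof := hCc u hu v
  have heta := hCη u hu v hv2
  have hK3v := hK3 u v
  have hK4v := hK4 u v
  have hKRv := hKR u v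
  rw [show 4 + m = m + 4 by ring] at hKRv
  have hLv := hL v
  set ρ1 : ℝ := (r u v)⁻¹ with hρ1
  set ρ3 : ℝ := (r u v ^ (m + 3))⁻¹ with hρ3
  set ρ4 : ℝ := (r u v ^ (m + 4))⁻¹ with hρ4
  set Λ : ℝ := logRatio r u v with hΛ
  have hρ34 : ρ4 = ρ3 * ρ1 := by simp only [hρ3, hρ4, hρ1]; rw [← mul_inv, ← pow_succ]
  have hρ3pos : 0 < ρ3 := by positivity
  have hρ4pos : 0 < ρ4 := by positivity
  -- (a) the `m`-th derivative of the three pieces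
  have hle : ((m : ℕ) : WithTop ℕ∞) ≤ ((⊤ : ℕ∞) : WithTop ℕ∞) := by exact_mod_cast le_top
  have e1 : iteratedDeriv m (fun v ↦ (deriv (fun v' ↦ χ u v') v - (-(2 * M) * Fhat) * (r u v ^ 3)⁻¹) +
      (6 * I₀ * M) * (logRatio r u v * (r u v ^ 4)⁻¹)) v =
      iteratedDeriv (m + 1) (fun v' ↦ χ u v') v - (-(2 * M) * Fhat) * iteratedDeriv m (fun v ↦ (r u v ^ 3)⁻¹) v +
        (6 * I₀ * M) * iteratedDeriv m (fun v ↦ logRatio r u v * (r u v ^ 4)⁻¹) v := by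
    rw [iteratedDeriv_fun_add ((hD.sub (contDiff_const.mul hP3)).of_le hle).contDiffAt
      ((contDiff_const.mul hL4).of_le hle).contDiffAt,
      iteratedDeriv_fun_sub (hD.of_le hle).contDiffAt ((contDiff_const.mul hP3).of_le hle).contDiffAt,
      iteratedDeriv_const_mul _ (hP3.of_le hle).contDiffAt, iteratedDeriv_const_mul _ (hL4.of_le hle).contDiffAt,
      ← iteratedDeriv_succ']
  -- the field: `∂ᵥ^{m+1} χ = −∫ F_m`
  set Fm : ℝ → ℝ → ℝ := fun u' v ↦ iteratedDeriv m (fun v' ↦ radialPotential M (r u' v') * χ u' v') v with hFm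
  set Pm : ℝ → ℝ → ℝ := fun u' v ↦ iteratedDeriv m (fun v' ↦ radialPotential M (r u' v')) v with hPm
  have e2 : iteratedDeriv (m + 1) (fun v' ↦ χ u v') v = -uPrimitive Fm u v :=
    iteratedDeriv_succ_field_of_ge hr hM hHd hsupp hHb m u hv2
  -- (b) `∫ F_m = ∫ P_m χ(·,∞) + ∫ G`
  have hPm_eq : ∀ u', Pm u' v = (r u' v ^ (m + 3))⁻¹ * S.eval (r u' v)⁻¹ := fun u' ↦ by
    simp only [hPm, hS]
    rw [iteratedDeriv_potential_eq hr hM, ← inv_pow, show 3 + m = m + 3 by ring]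
  have hintF : IntegrableOn (fun u' ↦ Fm u' v) (Iic u) :=
    integrableOn_iteratedDeriv_potential_mul_field hr hM hHd hsupp hHb m u v
  have hintP : IntegrableOn (fun u' ↦ Pm u' v * χinf u') (Iic u) := by
    have h := integrableOn_inv_pow_mul_eval_mul_futureLimit hr hM hHd hsupp hHb hR h12 (m + 3) S hu v
    refine h.congr_fun (fun u' _ ↦ ?_) measurableSet_Iic
    simp only [hPm_eq u']
    rfl
  have e3 : uPrimitive Fm u v = (∫ u' in Iic u, Pm u' v * χinf u') +
      uPrimitive (fun u' v ↦ Fm u' v - Pm u' v * χinf u') u v := by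
    simp only [uPrimitive_apply]
    rw [integral_sub hintF hintP]
    ring
  -- (c) `∫ P_m χ(·,∞) = s Z + ∫ ρ^{3+m} (S(ρ) − s) χ(·,∞)`
  have hintZ : IntegrableOn (fun u' ↦ (r u' v ^ (m + 3))⁻¹ * χinf u') (Iic u) := by
    have h := integrableOn_inv_pow_mul_eval_mul_futureLimit hr hM hHd hsupp hHb hR h12 (m + 3) 1 hu v
    simpa using h
  have hintCof : IntegrableOn (fun u' ↦ (r u' v ^ (3 + m))⁻¹ * (S.eval (r u' v)⁻¹ - S.eval 0) * χinf u') (Iic u) := by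
    have h := integrableOn_inv_pow_mul_eval_mul_futureLimit hr hM hHd hsupp hHb hR h12 (3 + m) (S - C (S.eval 0)) hu v
    refine h.congr_fun (fun u' _ ↦ ?_) measurableSet_Iic
    simp only [eval_sub, eval_C]
    rfl
  have e4 : (∫ u' in Iic u, Pm u' v * χinf u') = s * (∫ u' in Iic u, (r u' v ^ (m + 3))⁻¹ * χinf u') +
      uPrimitive (fun u' v ↦ (r u' v ^ (3 + m))⁻¹ * (S.eval (r u' v)⁻¹ - S.eval 0) * χinf u') u v := by
    simp only [uPrimitive_apply]
    rw [← MeasureTheory.integral_const_mul, ← integral_add (hintZ.const_mul s) hintCof]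
    refine integral_congr_ae (Eventually.of_forall fun u' ↦ ?_)
    simp only [hPm_eq u', show 3 + m = m + 3 by ring, hs]
    ring
  -- abbreviate the three integrals (this also folds them inside `e3`, `e4` and the bounds)
  set Zv : ℝ := ∫ u' in Iic u, (r u' v ^ (m + 3))⁻¹ * χinf u' with hZv
  set Icof : ℝ := uPrimitive (fun u' v ↦ (r u' v ^ (3 + m))⁻¹ * (S.eval (r u' v)⁻¹ - S.eval 0) * χinf u') u v
    with hIcof
  set IG : ℝ := uPrimitive (fun u' v ↦ Fm u' v - Pm u' v * χinf u') u v with hIG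
  -- (d) `∂ᵥ^m (1/r³) = ρ^{3+m} cof3(ρ)`
  have e5 : iteratedDeriv m (fun v ↦ (r u v ^ 3)⁻¹) v = ρ3 * cof3.eval ρ1 := by
    have hfun : (fun v ↦ (r u v ^ 3)⁻¹) = fun v ↦ ((X : ℝ[X]) ^ 3 * 1).eval (r u v)⁻¹ := by
      funext v; simp [inv_pow]
    rw [hfun, iteratedDeriv_eval_invRadius hr hM, iterate_vDerivPoly_X_pow_mul (by norm_num)]
    simp only [eval_mul, eval_pow, eval_X, hρ3, hρ1, hcof3, ← inv_pow, show 3 + m = m + 3 by ring]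
  -- (e) `∂ᵥ^m (Λ/r⁴) = Λ ρ^{4+m} cof4(ρ) + R_m(ρ)`
  have e6 : iteratedDeriv m (fun v ↦ logRatio r u v * (r u v ^ 4)⁻¹) v = Λ * (ρ4 * cof4.eval ρ1) + R.eval ρ1 := by
    have hfun : (fun v ↦ logRatio r u v * (r u v ^ 4)⁻¹) =
        fun v ↦ logRatio r u v * ((X : ℝ[X]) ^ 4 * 1).eval (r u v)⁻¹ := by
      funext v; simp [inv_pow]
    rw [hfun, iteratedDeriv_logRatio_mul_eval hr hM, iterate_vDerivPoly_X_pow_mul (by norm_num)]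
    simp only [eval_mul, eval_pow, eval_X, hρ4, hρ1, hcof4, hΛ, hRdef, ← inv_pow, show 4 + m = m + 4 by ring]
  -- the remainder identity (the leading coefficients cancel)
  have hRem : iteratedDeriv m (fun v ↦ (deriv (fun v' ↦ χ u v') v - (-(2 * M) * Fhat) * (r u v ^ 3)⁻¹) +
      (6 * I₀ * M) * (logRatio r u v * (r u v ^ 4)⁻¹)) v =
      -(s * (Zv - ρ3 * Fhat - I₀ * ((m : ℝ) + 3) * Λ * ρ4)) - Icof - IG
        - (-(2 * M) * Fhat) * (ρ3 * (cof3.eval ρ1 - t))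
        + (6 * I₀ * M) * (Λ * (ρ4 * (cof4.eval ρ1 - w))) + (6 * I₀ * M) * R.eval ρ1 := by
    rw [e1, e2, e3, e4, e5, e6, hst]
    linear_combination (-2 * I₀ * M * Λ * ρ4) * htw
  rw [hRem, Real.norm_eq_abs, Real.norm_eq_abs, abs_of_pos hρ4pos]
  -- bound each term
  have hZ' : |Zv - ρ3 * Fhat - I₀ * ((m : ℝ) + 3) * Λ * ρ4| ≤ CZ * ρ4 := hZ
  have b1 : |-(s * (Zv - ρ3 * Fhat - I₀ * ((m : ℝ) + 3) * Λ * ρ4))| ≤ |s| * CZ * ρ4 := by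
    rw [abs_neg, abs_mul]
    calc |s| * |Zv - ρ3 * Fhat - I₀ * ((m : ℝ) + 3) * Λ * ρ4| ≤ |s| * (CZ * ρ4) :=
          mul_le_mul_of_nonneg_left hZ' (abs_nonneg _)
      _ = |s| * CZ * ρ4 := by ring
  have b2 : |Icof| ≤ Cc * (-u)⁻¹ * ρ4 := by rw [mul_assoc]; exact hcof
  have b3 : |IG| ≤ Cη * (-u)⁻¹ * ρ4 := by rw [mul_assoc]; exact heta
  have hK3v' : |cof3.eval ρ1 - t| ≤ K3 * ρ1 := hK3v
  have hK4v' : |cof4.eval ρ1 - w| ≤ K4 * ρ1 := hK4v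
  have b4 : |(-(2 * M) * Fhat) * (ρ3 * (cof3.eval ρ1 - t))| ≤ |(-(2 * M) * Fhat)| * K3 * ρ4 := by
    have hin : |ρ3 * (cof3.eval ρ1 - t)| ≤ K3 * ρ4 := by
      rw [abs_mul, abs_of_pos hρ3pos]
      calc ρ3 * |cof3.eval ρ1 - t| ≤ ρ3 * (K3 * ρ1) := mul_le_mul_of_nonneg_left hK3v' hρ3pos.le
        _ = K3 * ρ4 := by rw [hρ34]; ring
    calc |(-(2 * M) * Fhat) * (ρ3 * (cof3.eval ρ1 - t))| = |(-(2 * M) * Fhat)| * |ρ3 * (cof3.eval ρ1 - t)| :=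
          abs_mul _ _
      _ ≤ |(-(2 * M) * Fhat)| * (K3 * ρ4) := mul_le_mul_of_nonneg_left hin (abs_nonneg _)
      _ = |(-(2 * M) * Fhat)| * K3 * ρ4 := by ring
  have b5 : |(6 * I₀ * M) * (Λ * (ρ4 * (cof4.eval ρ1 - w)))| ≤ |6 * I₀ * M| * (K4 * L) * ρ4 := by
    have hLv' : |Λ| * ρ1 ≤ L := hLv
    have hin : |Λ * (ρ4 * (cof4.eval ρ1 - w))| ≤ K4 * L * ρ4 := by
      rw [abs_mul, abs_mul, abs_of_pos hρ4pos]
      calc |Λ| * (ρ4 * |cof4.eval ρ1 - w|) ≤ |Λ| * (ρ4 * (K4 * ρ1)) :=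
            mul_le_mul_of_nonneg_left (mul_le_mul_of_nonneg_left hK4v' hρ4pos.le) (abs_nonneg _)
        _ = K4 * (|Λ| * ρ1) * ρ4 := by ring
        _ ≤ K4 * L * ρ4 := mul_le_mul_of_nonneg_right (mul_le_mul_of_nonneg_left hLv' hK40) hρ4pos.le
    calc |(6 * I₀ * M) * (Λ * (ρ4 * (cof4.eval ρ1 - w)))| = |6 * I₀ * M| * |Λ * (ρ4 * (cof4.eval ρ1 - w))| :=
          abs_mul _ _
      _ ≤ |6 * I₀ * M| * (K4 * L * ρ4) := mul_le_mul_of_nonneg_left hin (abs_nonneg _)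
      _ = |6 * I₀ * M| * (K4 * L) * ρ4 := by ring
  have hKRv' : |R.eval ρ1| ≤ KR * ρ4 := hKRv
  have b6 : |(6 * I₀ * M) * R.eval ρ1| ≤ |6 * I₀ * M| * KR * ρ4 := by
    calc |(6 * I₀ * M) * R.eval ρ1| = |6 * I₀ * M| * |R.eval ρ1| := abs_mul _ _
      _ ≤ |6 * I₀ * M| * (KR * ρ4) := mul_le_mul_of_nonneg_left hKRv' (abs_nonneg _)
      _ = |6 * I₀ * M| * KR * ρ4 := by ring
  have htri : ∀ a b c d e f : ℝ, |a - b - c - d + e + f| ≤ |a| + |b| + |c| + |d| + |e| + |f| := by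
    intro a b c d e f
    calc |a - b - c - d + e + f| ≤ |a - b - c - d + e| + |f| := abs_add_le _ _
      _ ≤ |a - b - c - d| + |e| + |f| := by gcongr; exact abs_add_le _ _
      _ ≤ |a - b - c| + |d| + |e| + |f| := by gcongr; exact abs_sub _ _
      _ ≤ |a - b| + |c| + |d| + |e| + |f| := by gcongr; exact abs_sub _ _
      _ ≤ |a| + |b| + |c| + |d| + |e| + |f| := by gcongr; exact abs_sub _ _
  refine (htri _ _ _ _ _ _).trans ?_
  have hsum : |-(s * (Zv - ρ3 * Fhat - I₀ * ((m : ℝ) + 3) * Λ * ρ4))| + |Icof| + |IG| +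
      |(-(2 * M) * Fhat) * (ρ3 * (cof3.eval ρ1 - t))| + |(6 * I₀ * M) * (Λ * (ρ4 * (cof4.eval ρ1 - w)))| +
      |(6 * I₀ * M) * R.eval ρ1| ≤
      |s| * CZ * ρ4 + Cc * (-u)⁻¹ * ρ4 + Cη * (-u)⁻¹ * ρ4 + |(-(2 * M) * Fhat)| * K3 * ρ4 +
        |6 * I₀ * M| * (K4 * L) * ρ4 + |6 * I₀ * M| * KR * ρ4 := by
    linarith [b1, b2, b3, b4, b5, b6]
  refine hsum.trans (le_of_eq ?_)
  ring

end Base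

end VExp

end Literature.Barriers.FinalStateConjecture

end
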